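import Mathlib.RepresentationTheory.Irreducible
import Literature.NumberTheory.GaloisRepresentations.WeilDeligneRepFrobSemisimpleProofs
import HarnessLib

/-!
# The inertial dominance order `≺_I` on Weil–Deligne representations

Topic `Literature/NumberTheory/GaloisRepresentations`; dot-notation extensions of the accepted
structure `Literature.NumberTheory.GaloisRepresentations.WeilDeligneRep` (`WeilDeligneRep.lean`).

Let `F` be a non-archimedean local field with Weil group `W_F` and inertia group `I_F ≤ W_F`
(accepted `WeilGroup`, `WeilGroup.inertia`), and let `(ρ, N)`, `(ρ', N')` be Weil–Deligne
representations of `W_F` over a field `C` of characteristic `0` on spaces `V`, `V'`.  Since `N`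
commutes with `ρ(I_F)` (`deg = 0` on inertia), `N` preserves every isotypic component `V[θ]` of
the restriction `ρ|_{I_F}` (`θ` an irreducible representation of `I_F` with open kernel), and
the conjugacy class of the nilpotent `N[θ] := N|_{V[θ]}` is a partition of `dim V[θ]`.
I. Varma, *Local-global compatibility for regular algebraic cuspidal automorphic representations
when `ℓ ≠ p`*, Forum Math. Sigma 12 (2024) e21, **Definition 8.3** (p. 24): `(ρ, N) ≺_I (ρ', N')`
iff `ρ|_{I_F} ≅ ρ'|_{I_F}` and, for every such `θ` and every `i ≥ 1`,
`n_{1,θ} + ⋯ + n_{i,θ} ≤ n'_{1,θ} + ⋯ + n'_{i,θ}` for the Jordan partitions `(n_{j,θ})_j` of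
`N[θ]`, `(n'_{j,θ})_j` of `N'[θ]` (dominance order); **Proposition 8.8** (p. 26, proof): given
`ρ|_{I_F} ≅ ρ'|_{I_F}` (so `dim V[θ] = dim V'[θ]`), the partition condition is equivalent to
`rk N[θ]^j ≤ rk N'[θ]^j` for all `j ≥ 0` (Gerstenhaber; Bellaïche–Chenevier, *Families of Galois
representations and Selmer groups*, Astérisque 324, §7.8: `t(n) ≺ t(n') ⟺ ∀ i, rk nⁱ ≤ rk n'ⁱ`,
and the order `N₁ ≺_{I_F} N₂` defined isotypic component by isotypic component).  This is the
relation in which Varma's Theorem 2 (`WD(r_{p,ı}(π)|_{G_{F_v}})^{F-ss} ≺ ı⁻¹rec(π_v ⊗ |det|^{(1-n)/2})`)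
is proved: by her Lemma 8.4 (2) (= Bellaïche–Chenevier, Lemma 6.5.3), for Weil–Deligne
representations with isomorphic `W_F`-semisimplifications the order `≺` of her Definition 8.2
(dominance of the `Sp(m)`-partitions on the isotypic components for irreducible `W_F`-types up to
unramified twist) coincides with `≺_I`.

## Contents (all definitions have bodies; all lemmas are proved)

* `WeilDeligneRep.restrictInertia r` — `ρ|_{I_F}` as a representation of the subgroup `I_F`.
* `repIsotypic θ σ` — for representations `θ`, `σ` of a group `G` over `C`: the sum of the
  images of all `G`-equivariant maps `θ → σ` (Mathlib `Representation.IntertwiningMap`); for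
  `θ` irreducible this is the `θ`-isotypic component of `σ` (a non-zero equivariant map from an
  irreducible `θ` is injective, Mathlib `Representation.IsIrreducible.injective_or_eq_zero`, so
  its image is a copy of `θ`, and every copy of `θ` in `σ` is such an image).
* `WeilDeligneRep.inertiaIsotypic r θ = V[θ]` — `repIsotypic θ r.restrictInertia`; proved stable
  under `ρ(I_F)` (`ρ_apply_mem_inertiaIsotypic`) and under `N` (`map_N_inertiaIsotypic_le`,
  via `ρ_comp_N_of_mem_inertia`: `N` commutes with inertia), independent of the model of `θ`
  up to isomorphism (`inertiaIsotypic_congr_equiv`).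
* `WeilGroup.IsContinuousInertiaRep θ` — `θ : I_F → GL(V_θ)` has open kernel (is trivial on an
  open subgroup of `W_F` contained in `I_F`; same shape as the accepted
  `WeilGroup.IsContinuousRep`).
* `WeilDeligneRep.PrecI r r'` — **`r ≺_I r'`** (Varma Def. 8.3 in the rank form of Prop. 8.8):
  `ρ|_{I_F} ≅ ρ'|_{I_F}` (Mathlib `Representation.Equiv`) and for every `d`, every irreducible
  `θ : I_F → GL_d(C)` with open kernel (models `Fin d → C`; no generality lost by
  `inertiaIsotypic_congr_equiv`) and every `k`,
  `dim N^k(V[θ]) ≤ dim N'^k(V'[θ])` (`Module.finrank` of `Submodule.map (N ^ k) V[θ]`, which is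
  the rank of `N[θ]^k` since `N` preserves `V[θ]`).  API: `PrecI.refl`, `PrecI.trans`,
  `precI_congr` / `IsFrobSemisimplificationOf.precI_iff_left/right` (`≺_I` only sees `ρ|_{I_F}`
  and `N`, both unchanged by Frobenius-semisimplification — so "`r^{F-ss} ≺_I s`" may be stated
  as `r ≺_I s`), and `PrecI.map_N_inertiaIsotypic_eq_bot` (if `r ≺_I r'` and `N' = 0` then `N`
  kills every `V[θ]`).

Not vendored here: Varma's Definition 8.2 (`≺` through the classes of irreducible `W_F`-types up
to unramified twist and the decomposition `σ[ω]^{F-ss} ≅ ⊕ sᵢ ⊗ Sp(mᵢ)`), which needs the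
classification of indecomposable Frobenius-semisimple Weil–Deligne representations (Tate,
Corvallis (4.1.5)); by Lemma 8.4 (2) it is not needed to state Theorem 2 next to Theorem 1.
Mathlib has `isotypicComponent` for modules over a ring and `Representation.IsIrreducible`,
`Representation.IntertwiningMap`, `Representation.Equiv` (used), but no Weil–Deligne
representations.

## References

* I. Varma, Forum Math. Sigma 12 (2024) e21, doi:10.1017/fms.2024.7: Def. 8.2 (p. 23), Def. 8.3
  (p. 24), Lemma 8.4 (p. 24), Prop. 8.8 (p. 26). [VarmaFMS2024]
* J. Bellaïche, G. Chenevier, *Families of Galois representations and Selmer groups*, Astérisque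
  324 (2009), §7.8 (Gerstenhaber's theorem and the orders `≺`, `≺_{I_F}`; arXiv:math/0602340,
  Prop. 7.8.1, Def. 7.8.2, Def. 7.8.19). [BellaicheChenevier2009]
* J. Tate, *Number theoretic background*, Corvallis 1979, (4.1.2)–(4.1.5). [TateCorvallis1979]
-/

noncomputable section

open Module

namespace Literature.NumberTheory.GaloisRepresentations

/-! ### Isotypic components through equivariant maps -/

section RepIsotypic

variable {C : Type*} [Field C] {G : Type*} [Group G]
  {Vθ : Type*} [AddCommGroup Vθ] [Module C Vθ] {Vθ' : Type*} [AddCommGroup Vθ'] [Module C Vθ']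
  {V : Type*} [AddCommGroup V] [Module C V]

/-- The **`θ`-part of `σ` through equivariant maps**: the sum of the images of all
`G`-equivariant linear maps `θ → σ` (Mathlib `Representation.IntertwiningMap`).  For `θ`
irreducible every non-zero such map is injective (Schur), so this is the sum of all
subrepresentations of `σ` isomorphic to `θ`, i.e. the `θ`-isotypic component `V[θ]` of `σ`.
[cite: VarmaFMS2024, §8 (p. 24, "the isotypic component of σ|_{I_v}")] -/
def repIsotypic (θ : Representation C G Vθ) (σ : Representation C G V) : Submodule C V :=
  ⨆ f : θ.IntertwiningMap σ, LinearMap.range f.toLinearMap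

/-- The image of an equivariant map `θ → σ` lies in the `θ`-part of `σ`. [folklore] -/
theorem range_le_repIsotypic (θ : Representation C G Vθ) (σ : Representation C G V)
    (f : θ.IntertwiningMap σ) : LinearMap.range f.toLinearMap ≤ repIsotypic θ σ :=
  le_iSup (fun f : θ.IntertwiningMap σ => LinearMap.range f.toLinearMap) f

/-- The `θ`-part of `σ` is stable under `σ(g)`: `σ g (f x) = f (θ g x)`. [folklore] -/
theorem apply_mem_repIsotypic (θ : Representation C G Vθ) (σ : Representation C G V) (g : G)
    {v : V} (hv : v ∈ repIsotypic θ σ) : σ g v ∈ repIsotypic θ σ := by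
  have h : repIsotypic θ σ ≤ (repIsotypic θ σ).comap (σ g) := by
    refine iSup_le fun f => ?_
    rintro _ ⟨x, rfl⟩
    rw [Submodule.mem_comap]
    change σ g (f x) ∈ repIsotypic θ σ
    rw [← Representation.IntertwiningMap.isIntertwining θ σ f g x]
    exact range_le_repIsotypic θ σ f ⟨θ g x, rfl⟩
  exact h hv

/-- An endomorphism `T` of `V` commuting with `σ(G)` maps the `θ`-part into itself
(`T ∘ f` is again equivariant). [folklore] -/
theorem map_le_repIsotypic_of_comm (θ : Representation C G Vθ) (σ : Representation C G V)
    (T : V →ₗ[C] V) (hT : ∀ g : G, σ g ∘ₗ T = T ∘ₗ σ g) :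
    (repIsotypic θ σ).map T ≤ repIsotypic θ σ := by
  unfold repIsotypic
  rw [Submodule.map_iSup]
  refine iSup_le fun f => ?_
  let g' : θ.IntertwiningMap σ :=
    ⟨T ∘ₗ f.toLinearMap, fun g => by
      rw [LinearMap.comp_assoc, f.isIntertwining' g, ← LinearMap.comp_assoc, ← hT g,
        LinearMap.comp_assoc]⟩
  have h : (LinearMap.range f.toLinearMap).map T = LinearMap.range g'.toLinearMap :=
    (LinearMap.range_comp f.toLinearMap T).symm
  rw [h]
  exact le_iSup (fun f : θ.IntertwiningMap σ => LinearMap.range f.toLinearMap) g'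

/-- The `θ`-part only depends on `θ` up to isomorphism: precompose equivariant maps with an
isomorphism `θ ≅ θ'`. [folklore] -/
theorem repIsotypic_le_of_equiv {θ : Representation C G Vθ} {θ' : Representation C G Vθ'}
    (e : θ.Equiv θ') (σ : Representation C G V) : repIsotypic θ' σ ≤ repIsotypic θ σ := by
  refine iSup_le fun f => ?_
  have h : LinearMap.range f.toLinearMap ≤
      LinearMap.range (f.comp e.toIntertwiningMap).toLinearMap := by
    rintro _ ⟨x, rfl⟩
    refine ⟨e.symm x, ?_⟩
    simp only [Representation.IntertwiningMap.comp_toLinearMap, LinearMap.coe_comp,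
      Function.comp_apply]
    congr 1
    exact e.toLinearEquiv.apply_symm_apply x
  exact h.trans (range_le_repIsotypic θ σ _)

/-- Isomorphic `θ ≅ θ'` have the same part in `σ`. [folklore] -/
theorem repIsotypic_congr_equiv {θ : Representation C G Vθ} {θ' : Representation C G Vθ'}
    (e : θ.Equiv θ') (σ : Representation C G V) : repIsotypic θ σ = repIsotypic θ' σ :=
  le_antisymm (repIsotypic_le_of_equiv e.symm σ) (repIsotypic_le_of_equiv e σ)

end RepIsotypic

/-! ### Representations of the inertia group with open kernel -/

namespace WeilGroup

variable {F : Type*} [Field F] [ValuativeRel F] [TopologicalSpace F] [IsNonarchimedeanLocalField F]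
variable {C : Type*} [CommSemiring C] {Vθ : Type*} [AddCommMonoid Vθ] [Module C Vθ]

/-- A representation `θ` of the inertia group `I_F` on a discrete module **has open kernel**:
it is trivial on some open subgroup `U` of `W_F` contained in `I_F` (the shape of the accepted
`WeilGroup.IsContinuousRep`; Varma's "irreducible representations of `I_v` with open kernel",
the index set `𝓘`). [cite: VarmaFMS2024, §8 (p. 24, the set 𝓘)] -/
def IsContinuousInertiaRep (θ : Representation C (inertia F) Vθ) : Prop :=
  ∃ U : Subgroup (WeilGroup F), U ≤ inertia F ∧ IsOpen (U : Set (WeilGroup F)) ∧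
    ∀ (u : inertia F), (u : WeilGroup F) ∈ U → θ u = 1

/-- The trivial representation of `I_F` has open kernel (`U = I_F`, open by
`WeilGroup.isOpen_inertia`). [folklore] -/
theorem isContinuousInertiaRep_trivial :
    IsContinuousInertiaRep (Representation.trivial C (inertia F) Vθ) :=
  ⟨inertia F, le_rfl, isOpen_inertia F, fun _ _ => rfl⟩

end WeilGroup

/-! ### `ρ|_{I_F}`, the isotypic components `V[θ]`, and `≺_I` -/

namespace WeilDeligneRep

open WeilGroup

variable {F : Type*} [Field F] [ValuativeRel F] [TopologicalSpace F] [IsNonarchimedeanLocalField F]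
variable {C : Type*} [Field C] [CharZero C] {V : Type*} [AddCommGroup V] [Module C V]
  {V' : Type*} [AddCommGroup V'] [Module C V'] {V'' : Type*} [AddCommGroup V''] [Module C V'']
  {Vθ : Type*} [AddCommGroup Vθ] [Module C Vθ] {Vθ' : Type*} [AddCommGroup Vθ'] [Module C Vθ']

/-- The restriction `ρ|_{I_F}` of the Weil-group representation of `r = (ρ, N)` to the inertia
subgroup, as a representation of `↥(WeilGroup.inertia F)`.
[cite: TateCorvallis1979, (4.1.2)–(4.1.3)] -/
def restrictInertia (r : WeilDeligneRep F C V) : Representation C (inertia F) V :=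
  r.ρ.comp (inertia F).subtype

/-- Unfolding lemma for `restrictInertia`. [folklore] -/
@[simp] theorem restrictInertia_apply (r : WeilDeligneRep F C V) (u : inertia F) :
    r.restrictInertia u = r.ρ u := rfl

/-- **`N` commutes with inertia**: `ρ(u) N = N ρ(u)` for `u ∈ I_F` (the Weil–Deligne relation
with `deg u = 0`, `deg_eq_zero_of_mem_inertia`). [cite: TateCorvallis1979, (4.1.2)] -/
theorem ρ_comp_N_of_mem_inertia (r : WeilDeligneRep F C V) {u : WeilGroup F}
    (hu : u ∈ inertia F) : r.ρ u ∘ₗ r.N = r.N ∘ₗ r.ρ u := by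
  have h := r.conj_N u
  rwa [deg_eq_zero_of_mem_inertia hu, zpow_zero, one_smul] at h

/-- `ρ(u)` commutes with every power `N ^ k`, `u ∈ I_F`. [cite: TateCorvallis1979, (4.1.2)] -/
theorem ρ_comp_pow_N_of_mem_inertia (r : WeilDeligneRep F C V) {u : WeilGroup F}
    (hu : u ∈ inertia F) (k : ℕ) : r.ρ u ∘ₗ (r.N ^ k) = (r.N ^ k) ∘ₗ r.ρ u := by
  have h : Commute (r.ρ u) r.N := r.ρ_comp_N_of_mem_inertia hu
  exact h.pow_right k

/-- **The `θ`-isotypic component `V[θ]` of `ρ|_{I_F}`** (`θ` a representation of `I_F` on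
`V_θ`): the sum of the images of the `I_F`-equivariant maps `θ → ρ|_{I_F}` (`repIsotypic`); for
irreducible `θ` this is Varma's `σ[θ]`, "the isotypic component of `σ|_{I_v}` whose irreducible
subquotients are isomorphic to `θ`". [cite: VarmaFMS2024, §8 (p. 24) and Def. 8.3] -/
def inertiaIsotypic (r : WeilDeligneRep F C V) (θ : Representation C (inertia F) Vθ) :
    Submodule C V :=
  repIsotypic θ r.restrictInertia

/-- Unfolding lemma for `inertiaIsotypic`. [folklore] -/
theorem inertiaIsotypic_def (r : WeilDeligneRep F C V) (θ : Representation C (inertia F) Vθ) :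
    r.inertiaIsotypic θ =
      ⨆ f : θ.IntertwiningMap r.restrictInertia, LinearMap.range f.toLinearMap :=
  rfl

/-- `V[θ]` is stable under `ρ(I_F)`. [cite: VarmaFMS2024, §8 (p. 24)] -/
theorem ρ_apply_mem_inertiaIsotypic (r : WeilDeligneRep F C V)
    (θ : Representation C (inertia F) Vθ) {u : WeilGroup F} (hu : u ∈ inertia F) {v : V}
    (hv : v ∈ r.inertiaIsotypic θ) : r.ρ u v ∈ r.inertiaIsotypic θ :=
  apply_mem_repIsotypic θ r.restrictInertia ⟨u, hu⟩ hv

/-- **`N` preserves `V[θ]`** ("since `N` commutes with the image of `I_v`, these isotypic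
components are preserved by the monodromy operator"). [cite: VarmaFMS2024, §8 (p. 24)] -/
theorem map_N_inertiaIsotypic_le (r : WeilDeligneRep F C V)
    (θ : Representation C (inertia F) Vθ) : (r.inertiaIsotypic θ).map r.N ≤ r.inertiaIsotypic θ :=
  map_le_repIsotypic_of_comm θ r.restrictInertia r.N fun u => r.ρ_comp_N_of_mem_inertia u.2

/-- `N ^ k` preserves `V[θ]`. [cite: VarmaFMS2024, §8 (p. 24)] -/
theorem map_pow_N_inertiaIsotypic_le (r : WeilDeligneRep F C V)
    (θ : Representation C (inertia F) Vθ) (k : ℕ) :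
    (r.inertiaIsotypic θ).map (r.N ^ k) ≤ r.inertiaIsotypic θ :=
  map_le_repIsotypic_of_comm θ r.restrictInertia (r.N ^ k)
    fun u => r.ρ_comp_pow_N_of_mem_inertia u.2 k

/-- `V[θ]` depends on `θ` only up to isomorphism (so modelling `θ` on `Fin d → C` loses
nothing). [folklore] -/
theorem inertiaIsotypic_congr_equiv (r : WeilDeligneRep F C V)
    {θ : Representation C (inertia F) Vθ} {θ' : Representation C (inertia F) Vθ'}
    (e : θ.Equiv θ') : r.inertiaIsotypic θ = r.inertiaIsotypic θ' :=
  repIsotypic_congr_equiv e r.restrictInertia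

/-- Two Weil–Deligne representations on `V` with the same restriction to inertia have the same
isotypic components. [folklore] -/
theorem inertiaIsotypic_congr {r₁ r₂ : WeilDeligneRep F C V}
    (h : ∀ u ∈ inertia F, r₁.ρ u = r₂.ρ u) (θ : Representation C (inertia F) Vθ) :
    r₁.inertiaIsotypic θ = r₂.inertiaIsotypic θ := by
  have hI : r₁.restrictInertia = r₂.restrictInertia := by
    ext u : 1
    exact h u u.2
  rw [inertiaIsotypic, inertiaIsotypic, hI]

/-- Sanity check of the definition: for the trivial Weil–Deligne representation (`ρ = 1`,
`N = 0`) every vector lies in the isotypic component of the trivial character of `I_F`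
(`c ↦ c • v` is equivariant with image `∋ v`), so `V[1] = V`. [folklore] -/
theorem inertiaIsotypic_trivial_eq_top :
    (trivial C V : WeilDeligneRep F C V).inertiaIsotypic
        (Representation.trivial C (inertia F) C) = ⊤ := by
  rw [eq_top_iff]
  intro v _
  let f : (Representation.trivial C (inertia F) C).IntertwiningMap
      (trivial C V : WeilDeligneRep F C V).restrictInertia :=
    ⟨LinearMap.toSpanSingleton C V v, fun u => by
      ext
      simp [restrictInertia, trivial, ofRep]⟩
  refine range_le_repIsotypic _ _ f ⟨1, ?_⟩
  change LinearMap.toSpanSingleton C V v 1 = v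
  simp

/-- **Varma's dominance relation `r ≺_I r'`** (Def. 8.3, in the equivalent rank form of the
proof of Prop. 8.8): the restrictions to inertia are isomorphic, `ρ|_{I_F} ≅ ρ'|_{I_F}` (Mathlib
`Representation.Equiv`), and for every irreducible representation `θ` of `I_F` with open kernel
(modelled on `Fin d → C`, all `d`) and every `k ≥ 0`, `rk (N|_{V[θ]})^k ≤ rk (N'|_{V'[θ]})^k`,
i.e. `dim N^k(V[θ]) ≤ dim N'^k(V'[θ])`.  As printed, Def. 8.3 asks instead that the Jordan
partition `(n_{j,θ}(ρ,N))_j` of the nilpotent `N[θ]` be dominated by that of `N'[θ]`,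
`n_{1,θ} + ⋯ + n_{i,θ} ≤ n'_{1,θ} + ⋯ + n'_{i,θ}` for all `i ≥ 1`; given `ρ|_{I_F} ≅ ρ'|_{I_F}`
(hence `dim V[θ] = dim V'[θ]`) the two conditions are equivalent (Prop. 8.8, proof: "is
equivalent to the condition `rk N[θ]^j ≤ rk (N'[θ])^j ∀ j ≥ 0`"; Gerstenhaber's theorem,
Bellaïche–Chenevier §7.8).  Meaningful for finite-dimensional `V`, `V'`
(`Module.finrank`). [cite: VarmaFMS2024, Def. 8.3 (p. 24) and Prop. 8.8 (p. 26)] -/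
def PrecI (r : WeilDeligneRep F C V) (r' : WeilDeligneRep F C V') : Prop :=
  Nonempty (r.restrictInertia.Equiv r'.restrictInertia) ∧
    ∀ (d : ℕ) (θ : Representation C (inertia F) (Fin d → C)), θ.IsIrreducible →
      IsContinuousInertiaRep θ →
      ∀ k : ℕ, finrank C ↥((r.inertiaIsotypic θ).map (r.N ^ k)) ≤
        finrank C ↥((r'.inertiaIsotypic θ).map (r'.N ^ k))

/-- `≺_I` is reflexive. [cite: VarmaFMS2024, Def. 8.3] -/
theorem PrecI.refl (r : WeilDeligneRep F C V) : r.PrecI r :=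
  ⟨⟨Representation.Equiv.refl _⟩, fun _ _ _ _ _ => le_rfl⟩

/-- `≺_I` is transitive. [cite: VarmaFMS2024, Def. 8.3] -/
theorem PrecI.trans {r : WeilDeligneRep F C V} {r' : WeilDeligneRep F C V'}
    {r'' : WeilDeligneRep F C V''} (h : r.PrecI r') (h' : r'.PrecI r'') : r.PrecI r'' := by
  obtain ⟨⟨e⟩, h⟩ := h
  obtain ⟨⟨e'⟩, h'⟩ := h'
  exact ⟨⟨e.trans e'⟩, fun d θ hθ hθc k => (h d θ hθ hθc k).trans (h' d θ hθ hθc k)⟩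

/-- `≺_I` only sees `ρ|_{I_F}` and `N`: Weil–Deligne representations agreeing on inertia and in
`N` are `≺_I`-indistinguishable (left argument). [folklore] -/
theorem precI_congr_left {r₁ r₂ : WeilDeligneRep F C V} (hN : r₁.N = r₂.N)
    (hρ : ∀ u ∈ inertia F, r₁.ρ u = r₂.ρ u) (s : WeilDeligneRep F C V') :
    r₁.PrecI s ↔ r₂.PrecI s := by
  have hI : r₁.restrictInertia = r₂.restrictInertia := by
    ext u : 1
    exact hρ u u.2
  unfold PrecI inertiaIsotypic
  rw [hI, hN]

/-- `≺_I` only sees `ρ|_{I_F}` and `N` (right argument). [folklore] -/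
theorem precI_congr_right (r : WeilDeligneRep F C V) {s₁ s₂ : WeilDeligneRep F C V'}
    (hN : s₁.N = s₂.N) (hρ : ∀ u ∈ inertia F, s₁.ρ u = s₂.ρ u) :
    r.PrecI s₁ ↔ r.PrecI s₂ := by
  have hI : s₁.restrictInertia = s₂.restrictInertia := by
    ext u : 1
    exact hρ u u.2
  unfold PrecI inertiaIsotypic
  rw [hI, hN]

/-- **Frobenius-semisimplification does not change `≺_I`** (left): a Frobenius-semisimplification
has the same `N` and the same restriction to inertia (accepted `IsFrobSemisimplificationOf`), so
`r^{F-ss} ≺_I s ↔ r ≺_I s`. [cite: VarmaFMS2024, Def. 8.3] -/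
theorem IsFrobSemisimplificationOf.precI_iff_left {r' r : WeilDeligneRep F C V}
    (h : r'.IsFrobSemisimplificationOf r) (s : WeilDeligneRep F C V') :
    r'.PrecI s ↔ r.PrecI s :=
  precI_congr_left h.1 h.2.1 s

/-- Frobenius-semisimplification does not change `≺_I` (right). [cite: VarmaFMS2024, Def. 8.3] -/
theorem IsFrobSemisimplificationOf.precI_iff_right (r : WeilDeligneRep F C V)
    {s' s : WeilDeligneRep F C V'} (h : s'.IsFrobSemisimplificationOf s) :
    r.PrecI s' ↔ r.PrecI s :=
  precI_congr_right r h.1 h.2.1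

/-- If `r ≺_I r'` and `N' = 0`, then `N` kills every isotypic component `V[θ]` (`θ` irreducible
with open kernel): the case `k = 1` of the rank inequality (the mechanism by which `≺` against an
unramified right-hand side forces trivial monodromy, Varma Thm. 9.2, "in particular").
[cite: VarmaFMS2024, Def. 8.3 and Thm. 9.2] -/
theorem PrecI.map_N_inertiaIsotypic_eq_bot [FiniteDimensional C V] {r : WeilDeligneRep F C V}
    {r' : WeilDeligneRep F C V'} (h : r.PrecI r') (hN' : r'.N = 0) {d : ℕ}
    (θ : Representation C (inertia F) (Fin d → C)) (hθ : θ.IsIrreducible)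
    (hθc : IsContinuousInertiaRep θ) : (r.inertiaIsotypic θ).map r.N = ⊥ := by
  have h1 := h.2 d θ hθ hθc 1
  rw [pow_one, pow_one, hN', Submodule.map_zero, finrank_bot, Nat.le_zero] at h1
  exact Submodule.finrank_eq_zero.mp h1

end WeilDeligneRep

end Literature.NumberTheory.GaloisRepresentations

end
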